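import Literature.Geometry.Riemannian.CurvatureScale
import HarnessLib

/-!
# Perelman's pseudolocality theorem (Perelman 2002, Thm. 10.3; Kleiner–Lott, Cor. 35.1) —
# statement

G. Perelman, *The entropy formula for the Ricci flow and its geometric applications*,
arXiv:math/0211159 (2002), §10, Thm. 10.3: "There exist `ε, δ > 0` with the following property.
Suppose `g_{ij}(t)` is a smooth solution to the Ricci flow on `[0, (εr₀)²]`, and assume that at
`t = 0` we have `|Rm|(x) ≤ r₀⁻²` in `B(x₀, r₀)`, and `Vol B(x₀, r₀) ≥ (1 − δ) ωₙ r₀ⁿ`, where `ωₙ` is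
the volume of the unit ball in `ℝⁿ`. Then the estimate `|Rm|(x, t) ≤ (εr₀)⁻²` holds whenever
`0 ≤ t ≤ (εr₀)²`, `dist_t(x, x₀) < εr₀`." (The setting of §10 is a Ricci flow on a closed
manifold; detailed proof: B. Kleiner, J. Lott, *Notes on Perelman's papers*, Geom. Topol. 12 (2008),
Thm. 30.1 and Cor. 35.1.)

This file only STATES the theorem, in the tree's vocabulary (`IsRicciFlow`, frame-sense
curvature bounds `CurvatureBoundedOn`, `g.edist`, `g.riemVolume`, the Euclidean ball volume
`volume (Metric.ball 0 r₀)`), as the named fact `perelman_pseudolocality`. It is debt item D1 of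
the ε-regularity theorem of Bamler 2020a (Thm. 10.2, `bamler_epsilonRegularity`), whose blow-up
proof ends with "We therefore obtain a contradiction to `r_Rm(x'ᵢ, 0) = r'ᵢ` using Perelman's
Pseudolocality Theorem". Users take `(h : perelman_pseudolocality)`; the consumed frame-sense form
at the later times is `curvatureBoundedOn_of_perelman_pseudolocality`.

## References

* G. Perelman, *The entropy formula for the Ricci flow and its geometric applications*,
  arXiv:math/0211159 (2002), §10, Thm. 10.1 and Thm. 10.3. [Perelman2002]
* B. Kleiner, J. Lott, *Notes on Perelman's papers*, Geom. Topol. 12 (2008), 2587–2855, §30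
  Thm. 30.1, §35 Cor. 35.1 (detailed proof; no bib key in the tree).
-/

noncomputable section

open Set MeasureTheory
open scoped Manifold ContDiff Topology ENNReal NNReal

namespace Literature.Geometry.Riemannian

open Lorentzian Lorentzian.PseudoRiemannianMetric

/-- NAMED FACT (**Perelman 2002, Thm. 10.3; Kleiner–Lott 2008, Cor. 35.1 — pseudolocality,
curvature form**): for every `m ≥ 2` there are `ε, δ, c > 0` such that for every Ricci flow
`(h, cov)` on `[a, T]` of a smooth family of Riemannian metrics on a closed connected `m`-manifold
(modelled on `ℝᵐ`), every `x₀`, `t₀ ∈ [a, T]` and `r₀ > 0`: if at time `t₀` one has `|Rm| ≤ c r₀⁻²`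
in the frame sense of the tree on the `g_{t₀}`-ball `B_{t₀}(x₀, r₀)` (the dimensional constant `c`
converts the frame-sense bound into the source's bound `|Rm|_g ≤ r₀⁻²` on the tensor norm) and
`Vol_{g_{t₀}} B_{t₀}(x₀, r₀) ≥ (1 − δ) ω_m r₀ᵐ` (`ω_m r₀ᵐ` = the Lebesgue volume of the Euclidean
`r₀`-ball), then `|Rm| ≤ (ε r₀)⁻²` (frame sense) at every `(x, t)` with `t ∈ [t₀, t₀ + (ε r₀)²]`,
`t ≤ T`, and `d_{g_t}(x₀, x) < ε r₀` (the conclusion `|Rm|_g ≤ (εr₀)⁻²` of the source implies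
the frame-sense bound with the same constant). Special case of the sources (time-shifted to `t₀`,
closed manifolds, frame-sense curvature bounds with the conversion constant `c` on the
hypothesis side). -- TODO(general form): Thm. 10.1 (with the isoperimetric hypothesis and the `|Rm| ≤ α t⁻¹ + (εr₀)⁻²` conclusion) and complete non-compact flows.
[cite: Perelman2002, §10, Thm. 10.3] -/
def perelman_pseudolocality : Prop :=
  ∀ (m : ℕ), 2 ≤ m → ∃ ε δ c : ℝ, 0 < ε ∧ 0 < δ ∧ 0 < c ∧
    ∀ (M : Type) [TopologicalSpace M] [ChartedSpace (EuclideanSpace ℝ (Fin m)) M]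
      [IsManifold 𝓘(ℝ, EuclideanSpace ℝ (Fin m)) ∞ M] [T2Space M] [CompactSpace M]
      [SecondCountableTopology M] [MeasurableSpace M] [BorelSpace M] [ConnectedSpace M]
      (h : ℝ → PseudoRiemannianMetric 𝓘(ℝ, EuclideanSpace ℝ (Fin m)) ∞ (EuclideanSpace ℝ (Fin m))
        (TangentSpace 𝓘(ℝ, EuclideanSpace ℝ (Fin m)) : M → Type _))
      (cov : ℝ → CovariantDerivative 𝓘(ℝ, EuclideanSpace ℝ (Fin m)) (EuclideanSpace ℝ (Fin m))
        (TangentSpace 𝓘(ℝ, EuclideanSpace ℝ (Fin m)) : M → Type _))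
      (a T : ℝ) (_hflow : IsRicciFlow h cov (Icc a T)) (_hh : IsContMDiffFamilyOn ∞ h univ)
      (hR : ∀ s, (h s).IsRiemannian) (x₀ : M) (t₀ r₀ : ℝ), t₀ ∈ Icc a T → 0 < r₀ →
      CurvatureBoundedOn (h t₀) (cov t₀) {y | (h t₀).edist (hR t₀) x₀ y < ENNReal.ofReal r₀}
        (c * (r₀ ^ 2)⁻¹) →
      ENNReal.ofReal ((1 - δ) * (volume (Metric.ball (0 : EuclideanSpace ℝ (Fin m)) r₀)).toReal) ≤
        (h t₀).riemVolume {y | (h t₀).edist (hR t₀) x₀ y < ENNReal.ofReal r₀} →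
      ∀ t ∈ Icc t₀ (t₀ + (ε * r₀) ^ 2), t ≤ T →
        CurvatureBoundedOn (h t) (cov t) {x | (h t).edist (hR t) x₀ x < ENNReal.ofReal (ε * r₀)}
          ((ε * r₀) ^ 2)⁻¹

/-- **Consequence (conditional on the fact): the consumed frame-sense form at the centre** —
under `perelman_pseudolocality`, in its setting the curvature at the centre point `x₀` stays
bounded by `(ε r₀)⁻²` for the times `t ∈ [t₀, t₀ + (ε r₀)²] ∩ [a, T]`.
[cite: Perelman2002, §10, Thm. 10.3] -/
theorem curvatureBoundedOn_of_perelman_pseudolocality (hP : perelman_pseudolocality) (m : ℕ)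
    (hm : 2 ≤ m) : ∃ ε δ c : ℝ, 0 < ε ∧ 0 < δ ∧ 0 < c ∧
    ∀ (M : Type) [TopologicalSpace M] [ChartedSpace (EuclideanSpace ℝ (Fin m)) M]
      [IsManifold 𝓘(ℝ, EuclideanSpace ℝ (Fin m)) ∞ M] [T2Space M] [CompactSpace M]
      [SecondCountableTopology M] [MeasurableSpace M] [BorelSpace M] [ConnectedSpace M]
      (h : ℝ → PseudoRiemannianMetric 𝓘(ℝ, EuclideanSpace ℝ (Fin m)) ∞ (EuclideanSpace ℝ (Fin m))
        (TangentSpace 𝓘(ℝ, EuclideanSpace ℝ (Fin m)) : M → Type _))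
      (cov : ℝ → CovariantDerivative 𝓘(ℝ, EuclideanSpace ℝ (Fin m)) (EuclideanSpace ℝ (Fin m))
        (TangentSpace 𝓘(ℝ, EuclideanSpace ℝ (Fin m)) : M → Type _))
      (a T : ℝ) (_hflow : IsRicciFlow h cov (Icc a T)) (_hh : IsContMDiffFamilyOn ∞ h univ)
      (hR : ∀ s, (h s).IsRiemannian) (x₀ : M) (t₀ r₀ : ℝ), t₀ ∈ Icc a T → 0 < r₀ →
      CurvatureBoundedOn (h t₀) (cov t₀) {y | (h t₀).edist (hR t₀) x₀ y < ENNReal.ofReal r₀}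
        (c * (r₀ ^ 2)⁻¹) →
      ENNReal.ofReal ((1 - δ) * (volume (Metric.ball (0 : EuclideanSpace ℝ (Fin m)) r₀)).toReal) ≤
        (h t₀).riemVolume {y | (h t₀).edist (hR t₀) x₀ y < ENNReal.ofReal r₀} →
      ∀ t ∈ Icc t₀ (t₀ + (ε * r₀) ^ 2), t ≤ T →
        CurvatureBoundedOn (h t) (cov t) {x₀} ((ε * r₀) ^ 2)⁻¹ := by
  obtain ⟨ε, δ, c, hε, hδ, hc, hP⟩ := hP m hm
  refine ⟨ε, δ, c, hε, hδ, hc, ?_⟩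
  intro M _ _ _ _ _ _ _ _ _ h cov a T hflow hh hR x₀ t₀ r₀ ht₀ hr₀ hRm hvol t ht htT
  have hball := hP M h cov a T hflow hh hR x₀ t₀ r₀ ht₀ hr₀ hRm hvol t ht htT
  refine hball.mono (fun x hx ↦ ?_) le_rfl
  rw [mem_singleton_iff.1 hx, mem_setOf_eq, PseudoRiemannianMetric.edist_self]
  exact ENNReal.ofReal_pos.2 (by positivity)

end Literature.Geometry.Riemannian

end
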